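import Summits.HubbardSuperconductivity.HubbardSuperconductivity.Theorems.BalabanIRBirComplexStableXYRStubSectorConjugation
import Summits.HubbardSuperconductivity.HubbardSuperconductivity.Theorems.BalabanIRBirComplexStableXYRStubLinearPartSector
import Summits.HubbardSuperconductivity.HubbardSuperconductivity.Theorems.BalabanIRBirComplexStableXYRStubPathCfgConst
import Summits.HubbardSuperconductivity.HubbardSuperconductivity.Theorems.BalabanIRBirComplexStableXYRGaussianReality
import Literature.MathematicalPhysics.QuantumFieldTheory.TorusChartSpinWaveGauge
import HarnessLib

/-!
# Crux `BirComplexStableXYR` (stmt-HubbardSuperconductivity-14845), line `fat-gaussian-defect-calculus`: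
# stub H5 `stub_twistIntegralConj` — conjugating the twisted vortex-free integrals flips the twist

Registered stub (lead c8, wave 10; skeleton `Cruxes/BirComplexStableXYR/Lines/fat_gaussian_defect_calculus.lean`),
helper (`--supports`) for the crux
`Summit.HubbardSuperconductivity.HubbardSuperconductivity.Theses.BalabanIR.BirComplexStableXYR`.

**Statement.** On the engine's torus `Λ L M = (ℤ/L)² × ℤ/M` (chart `F = TorusChart.piProdZMod 2 L M`) let `P ω s` be the
window path configuration of a real `1`-cochain `ω` (hypothesis `hP`), `Q` the real quadratic form of the table (`hQ`),
`W_v(η) = ∫_{[-π,π]} g_v(η − τ) dτ` the smoothed box.  For a window table `c` with (U1), (R), (P), every real `K`, every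
variance `v` and every CONSTANT real twist `x i ↦ t i`, the pinned twisted vortex-free integral
`I(t) = ∫ e^{−(K/2)Σ_s Q(P_s d₀ψ̂)} Π_s exp(−K·genF c (P_s(d₀ψ̂ − t)) + (K/2)·Q(P_s(d₀ψ̂ − t))) Π_{x,i} W_v(d₀ψ̂(x,i) − t i) dψ`
over the fields `ψ` of the punctured torus (`ψ̂ = extZero ψ`) satisfies `conj I(t) = I(−t)`.

**Proof.** (0) `conj ∫ = ∫ conj` (`integral_conj`); conjugation fixes the real thin Gaussian and bond weights and
conjugates `genF` in the local factors (`hsc_twc_assemble`).  (1) `ψ ↦ ψ ∘ neg` is a volume-preserving coordinate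
permutation of `ℝ^{Λ∖0}` with `extZero (ψ ∘ neg) = (extZero ψ) ∘ neg` (`hsc_twc_integral_extZero_comp_neg`).
(2) Geometry (`hsc_twc_window`): for `φ̃ = φ ∘ neg`, `P_s(d₀φ̃ − t) = (P_{σ s}(d₀φ + t)) ∘ RP + C_s` with the full window
inversion `RP = (rev, rev, rev)`, the base-point involution `σ s = −s − d⋆` (`greal_sh_inv`) and a constant `C_s`
(`linearPartSector_staircase`, `stub_pathCfg_const`).  (3) By (R)∧(P) `genF c (u ∘ RP) = conj (genF c u)`
(`CoreBL.genF_comp_winv`, `timeReflection_functional_of_table`) and `Q (u ∘ RP) = Q u` (`greal_table_inv`); by (U1)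
constants are invisible (`cvxr_frq_add_const`); re-index `s ↦ σ s`.  (4) Bond weights: `d₀φ̃(x,i) = −d₀φ(−x−e_i, i)`,
evenness `smoothedBox_even`, bijection `x ↦ −x − e_i` (`hsc_twc_bond`).  Elementary; no definition; sorry-free.
[folklore: Fröhlich–Spencer, CMP 81 (1981) §3, charge conjugation `h ↔ −h` of the holonomy sectors]
-/

set_option linter.dupNamespace false -- `Summit.<S>.<S>.Theorems…` repeats the summit name (D-0017 layout)

noncomputable section

namespace Summit.HubbardSuperconductivity.HubbardSuperconductivity.Theorems.FSUnfolding

open scoped BigOperators ComplexConjugate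
open MeasureTheory Literature.MathematicalPhysics.QuantumFieldTheory Literature.Probability.LatticeModels
open Summit.HubbardSuperconductivity.BirComplexStableXYNegative

/-! ## Window level: the full inversion `RP = (rev, rev, rev)` and constant shifts -/

/-- Re-indexing the pairing by the full window inversion `RP` (an involution). [folklore] -/
theorem hsc_twc_frq_RP {r : ℕ} (n : Freq r) (u : W r → ℝ) :
    (∑ w, (n w : ℝ) * u (Fin.rev w.1, Fin.rev w.2.1, Fin.rev w.2.2)) =
      ∑ w, ((n (Fin.rev w.1, Fin.rev w.2.1, Fin.rev w.2.2) : ℤ) : ℝ) * u w := by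
  have hinv : Function.Involutive
      (fun w : W r => ((Fin.rev w.1, Fin.rev w.2.1, Fin.rev w.2.2) : W r)) := by
    intro w; simp [Fin.rev_rev]
  refine Fintype.sum_equiv (hinv.toPerm _) _ _ fun w => ?_
  simp only [Function.Involutive.coe_toPerm, Fin.rev_rev, Prod.mk.eta]

/-- **Re-indexing the table by `n ↦ −(n ∘ RP)`.**  If `c (n ∘ RP) = conj (c (−n))` for every frequency (this is
(R)∧(P), `greal_table_inv`), then for every `f`,
`Σ_n c_n f(n ∘ RP) = conj (Σ_n c_n conj (f (−n)))`. [folklore] -/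
theorem hsc_twc_sum_RP {r : ℕ} (c : Table r)
    (hRP : ∀ n : Freq r, c (fun w => n (Fin.rev w.1, Fin.rev w.2.1, Fin.rev w.2.2)) = conj (c (-n)))
    (f : Freq r → ℂ) :
    c.sum (fun n a => a * f (fun w => n (Fin.rev w.1, Fin.rev w.2.1, Fin.rev w.2.2))) =
      conj (c.sum (fun n a => a * conj (f (-n)))) := by
  have hTinv : Function.Involutive
      (fun n : Freq r => -(fun w : W r => n (Fin.rev w.1, Fin.rev w.2.1, Fin.rev w.2.2))) := by
    intro n; funext w; simp [Fin.rev_rev]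
  set T : Equiv.Perm (Freq r) := hTinv.toPerm _
  have hT : ∀ (n : Freq r) (w : W r), (T n) w = -(n (Fin.rev w.1, Fin.rev w.2.1, Fin.rev w.2.2)) :=
    fun n w => rfl
  have hcT : ∀ n, c (T n) = conj (c n) := by
    intro n
    have h := hRP (-n)
    rw [neg_neg] at h
    rw [← h]
    rfl
  simp only [Finsupp.sum, map_sum, map_mul, Complex.conj_conj]
  refine Finset.sum_equiv T (fun n => ?_) (fun n _ => ?_)
  · simp only [Finsupp.mem_support_iff, hcT n, map_ne_zero]
  · rw [hcT n, Complex.conj_conj]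
    congr 2
    funext w
    rw [Pi.neg_apply, hT, neg_neg]

/-- **(R)∧(P) ⇒ `genF c (u ∘ RP) = conj (genF c u)`** (`u ∘ RP = (u ∘ R) ∘ P`; (P) by `CoreBL.genF_comp_winv`,
(R) by `timeReflection_functional_of_table`). [folklore] -/
theorem hsc_twc_genF_RP {r : ℕ} (c : Table r)
    (hR : ∀ n : Freq r, c (fun w => n (w.1, w.2.1, Fin.rev w.2.2)) = conj (c (-n)))
    (hP : ∀ n : Freq r, c (fun w => n (Fin.rev w.1, Fin.rev w.2.1, w.2.2)) = c n) (u : W r → ℝ) :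
    genF c (fun w => u (Fin.rev w.1, Fin.rev w.2.1, Fin.rev w.2.2)) = conj (genF c u) := by
  have h1 : genF c (fun w => u (Fin.rev w.1, Fin.rev w.2.1, Fin.rev w.2.2)) =
      genF c (fun w' : W r => u (w'.1, w'.2.1, Fin.rev w'.2.2)) :=
    CoreBL.genF_comp_winv c hP (fun w' : W r => u (w'.1, w'.2.1, Fin.rev w'.2.2))
  rw [h1]
  exact timeReflection_functional_of_table r c hR u

/-- **(R)∧(P) ⇒ the quadratic form is `RP`-invariant**: `Q (u ∘ RP) = Q u` (re-index the table by
`n ↦ −(n ∘ RP)`; the square is even and real). [folklore] -/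
theorem hsc_twc_Q_RP {r : ℕ} (c : Table r)
    (hR : ∀ n : Freq r, c (fun w => n (w.1, w.2.1, Fin.rev w.2.2)) = conj (c (-n)))
    (hP : ∀ n : Freq r, c (fun w => n (Fin.rev w.1, Fin.rev w.2.1, w.2.2)) = c n)
    (Q : (W r → ℝ) → ℝ)
    (hQ : ∀ u : W r → ℝ, Q u = (-c.sum (fun n a => a * (((∑ w, (n w : ℝ) * u w) ^ 2 : ℝ) : ℂ))).re)
    (u : W r → ℝ) :
    Q (fun w => u (Fin.rev w.1, Fin.rev w.2.1, Fin.rev w.2.2)) = Q u := by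
  rw [hQ, hQ]
  have h1 : (c.sum fun n a => a *
      (((∑ w, (n w : ℝ) * u (Fin.rev w.1, Fin.rev w.2.1, Fin.rev w.2.2)) ^ 2 : ℝ) : ℂ)) =
      c.sum (fun n a => a *
        (((∑ w, ((n (Fin.rev w.1, Fin.rev w.2.1, Fin.rev w.2.2) : ℤ) : ℝ) * u w) ^ 2 : ℝ) : ℂ)) := by
    refine Finsupp.sum_congr fun n _ => ?_
    rw [hsc_twc_frq_RP n u]
  rw [h1, hsc_twc_sum_RP c (greal_table_inv c hR hP)
    (fun m : Freq r => (((∑ w, (m w : ℝ) * u w) ^ 2 : ℝ) : ℂ)), ← map_neg, Complex.conj_re]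
  congr 2
  refine Finsupp.sum_congr fun n _ => ?_
  have hn : (∑ w, ((-n) w : ℝ) * u w) = -∑ w, (n w : ℝ) * u w := by
    simp only [Pi.neg_apply, Int.cast_neg, neg_mul, Finset.sum_neg_distrib]
  rw [Complex.conj_ofReal, hn, neg_sq]

/-- **(U1) ⇒ constants are invisible to `genF`**: `genF c (u + C) = genF c u` (`cvxr_frq_add_const`). [folklore] -/
theorem hsc_twc_genF_add_const {r : ℕ} (c : Table r) (hU1 : ∀ n ∈ c.support, ∑ w, n w = 0)
    (u : W r → ℝ) (C : ℝ) :
    genF c (fun w => u w + C) = genF c u := by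
  simp only [genF]
  refine Finsupp.sum_congr fun n hn => ?_
  rw [cvxr_frq_add_const n (hU1 n hn) u C]

/-- **(U1) ⇒ constants are invisible to the quadratic form**: `Q (u + C) = Q u`. [folklore] -/
theorem hsc_twc_Q_add_const {r : ℕ} (c : Table r) (hU1 : ∀ n ∈ c.support, ∑ w, n w = 0)
    (Q : (W r → ℝ) → ℝ)
    (hQ : ∀ u : W r → ℝ, Q u = (-c.sum (fun n a => a * (((∑ w, (n w : ℝ) * u w) ^ 2 : ℝ) : ℂ))).re)
    (u : W r → ℝ) (C : ℝ) :
    Q (fun w => u w + C) = Q u := by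
  rw [hQ, hQ]
  congr 2
  refine Finsupp.sum_congr fun n hn => ?_
  rw [cvxr_frq_add_const n (hU1 n hn) u C]

/-! ## Torus level: the reflected window configurations -/

section Twist

variable {r L M : ℕ} [NeZero L] [NeZero M]
  (P : (Λ L M → Fin 3 → ℝ) → Λ L M → W r → ℝ)
  (hPdef : ∀ (ω : Λ L M → Fin 3 → ℝ) (s : Λ L M) (w : W r), P ω s w =
    (TorusChart.piProdZMod 2 L M).lineSum ω 0 (w.1 : ℕ) s
      + (TorusChart.piProdZMod 2 L M).lineSum ω 1 (w.2.1 : ℕ) (s + (w.1 : ℕ) • (TorusChart.piProdZMod 2 L M).gen 0)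
      + (TorusChart.piProdZMod 2 L M).lineSum ω 2 (w.2.2 : ℕ)
        (s + (w.1 : ℕ) • (TorusChart.piProdZMod 2 L M).gen 0 + (w.2.1 : ℕ) • (TorusChart.piProdZMod 2 L M).gen 1))
include hPdef

/-- **Geometry of the reflection.**  For `φ̃ = φ ∘ neg` and a constant twist `t`, the window path configuration
`P_s(d₀φ̃ − t)` is `(P_{σ s}(d₀φ + t)) ∘ RP + C_s` for the base-point involution `σ s = −s − d⋆`: staircase = endpoint
difference minus `w·t` (`linearPartSector_staircase`, `stub_pathCfg_const`), `sh (σ s) (RP w) = −sh s w`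
(`greal_sh_inv`) and `(RP w)·t = (r−1)Σ_i t_i − w·t`. [folklore] -/
theorem hsc_twc_window (φ : Λ L M → ℝ) (t : Fin 3 → ℝ) :
    ∃ e : Λ L M ≃ Λ L M, ∀ s : Λ L M, ∃ C : ℝ, ∀ w : W r,
      P (fun x i => (TorusChart.piProdZMod 2 L M).d₀ (fun y => φ (-y)) x i - t i) s w =
        P (fun x i => (TorusChart.piProdZMod 2 L M).d₀ φ x i - -t i) (e s)
          (Fin.rev w.1, Fin.rev w.2.1, Fin.rev w.2.2) + C := by
  -- staircase of `d₀θ − τ` for a constant `τ`: endpoint difference minus `w · τ`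
  have hsub : ∀ (θ : Λ L M → ℝ) (τ : Fin 3 → ℝ) (s : Λ L M) (w : W r),
      P (fun x i => (TorusChart.piProdZMod 2 L M).d₀ θ x i - τ i) s w =
        θ (sh L M s w) - θ s - (((w.1 : ℕ) : ℝ) * τ 0 + ((w.2.1 : ℕ) : ℝ) * τ 1 + ((w.2.2 : ℕ) : ℝ) * τ 2) := by
    intro θ τ s w
    rw [← stub_pathCfg_const r L M P hPdef τ s w,
      hPdef (fun x i => (TorusChart.piProdZMod 2 L M).d₀ θ x i - τ i), hPdef (fun _ i => τ i)]
    exact linearPartSector_staircase r L M θ (fun _ i => τ i) s w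
  -- the base-point reflection `σ s = -s - d⋆`, an involution of the torus
  have hinv : Function.Involutive (fun s : Λ L M =>
      -s - ((![((r : ℕ) : ZMod L) - 1, ((r : ℕ) : ZMod L) - 1], ((r : ℕ) : ZMod M) - 1) : Λ L M)) := by
    intro s
    dsimp only
    abel
  refine ⟨hinv.toPerm _, fun s =>
    ⟨φ (-s - (![((r : ℕ) : ZMod L) - 1, ((r : ℕ) : ZMod L) - 1], ((r : ℕ) : ZMod M) - 1)) - φ (-s)
      - ((r - 1 : ℕ) : ℝ) * (t 0 + t 1 + t 2), fun w => ?_⟩⟩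
  simp only [Function.Involutive.coe_toPerm]
  rw [hsub, hsub, greal_sh_inv s w]
  -- casts of `Fin.rev`
  have hrev : ∀ k : Fin r, (((Fin.rev k : Fin r) : ℕ) : ℝ) = ((r - 1 : ℕ) : ℝ) - ((k : ℕ) : ℝ) := by
    intro k
    have hk := k.isLt
    have h1 : ((Fin.rev k : Fin r) : ℕ) = (r - 1) - (k : ℕ) := by rw [Fin.val_rev]; omega
    rw [h1, Nat.cast_sub (by omega)]
  simp only [hrev]
  ring

/-- **Transfer of window functionals through the reflection.**  If `f (u ∘ RP) = g u` and `f` does not see constant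
shifts, then `s ↦ f (P_s(d₀φ̃ − t))` is a re-indexing of `s ↦ g (P_s(d₀φ + t))` (`hsc_twc_window`). [folklore] -/
theorem hsc_twc_transfer {β : Type*} (f g : (W r → ℝ) → β)
    (hfg : ∀ u : W r → ℝ, f (fun w => u (Fin.rev w.1, Fin.rev w.2.1, Fin.rev w.2.2)) = g u)
    (hfC : ∀ (u : W r → ℝ) (C : ℝ), f (fun w => u w + C) = f u)
    (φ : Λ L M → ℝ) (t : Fin 3 → ℝ) :
    ∃ e : Λ L M ≃ Λ L M, ∀ s : Λ L M,
      f (P (fun x i => (TorusChart.piProdZMod 2 L M).d₀ (fun y => φ (-y)) x i - t i) s) =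
        g (P (fun x i => (TorusChart.piProdZMod 2 L M).d₀ φ x i - -t i) (e s)) := by
  obtain ⟨e, he⟩ := hsc_twc_window P hPdef φ t
  refine ⟨e, fun s => ?_⟩
  obtain ⟨C, hC⟩ := he s
  rw [show P (fun x i => (TorusChart.piProdZMod 2 L M).d₀ (fun y => φ (-y)) x i - t i) s =
      fun w => P (fun x i => (TorusChart.piProdZMod 2 L M).d₀ φ x i - -t i) (e s)
        (Fin.rev w.1, Fin.rev w.2.1, Fin.rev w.2.2) + C from funext hC, hfC, hfg]

variable (c : Table r) (hU1 : ∀ n ∈ c.support, ∑ w, n w = 0)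
  (hR : ∀ n : Freq r, c (fun w => n (w.1, w.2.1, Fin.rev w.2.2)) = conj (c (-n)))
  (hP : ∀ n : Freq r, c (fun w => n (Fin.rev w.1, Fin.rev w.2.1, w.2.2)) = c n)
  (Q : (W r → ℝ) → ℝ)
  (hQ : ∀ u : W r → ℝ, Q u = (-c.sum (fun n a => a * (((∑ w, (n w : ℝ) * u w) ^ 2 : ℝ) : ℂ))).re)
include hU1 hR hP hQ

/-- **The thin Gaussian is reflection invariant**: `Σ_s Q(P_s(d₀φ̃)) = Σ_s Q(P_s(d₀φ))` for `φ̃ = φ ∘ neg`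
(`hsc_twc_transfer` at twist `0` with `f = g = Q`, then re-index `s`). [folklore] -/
theorem hsc_twc_thin (φ : Λ L M → ℝ) :
    ∑ s : Λ L M, Q (P ((TorusChart.piProdZMod 2 L M).d₀ (fun y => φ (-y))) s) =
      ∑ s : Λ L M, Q (P ((TorusChart.piProdZMod 2 L M).d₀ φ) s) := by
  obtain ⟨e, he⟩ := hsc_twc_transfer P hPdef Q Q (hsc_twc_Q_RP c hR hP Q hQ)
    (hsc_twc_Q_add_const c hU1 Q hQ) φ (fun _ => 0)
  simp only [sub_zero, neg_zero] at he
  exact Fintype.sum_equiv e _ _ he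

/-- **The local factors are reflection conjugated**: for `φ̃ = φ ∘ neg`,
`conj Π_s exp(−K genF c (P_s(d₀φ̃ − t)) + (K/2) Q(P_s(d₀φ̃ − t))) = Π_s exp(−K genF c (P_s(d₀φ + t)) + (K/2) Q(P_s(d₀φ + t)))`
(`hsc_twc_transfer` with `hsc_twc_genF_RP`, `hsc_twc_Q_RP`, `hsc_twc_genF_add_const`, `hsc_twc_Q_add_const`). [folklore] -/
theorem hsc_twc_local (K : ℝ) (φ : Λ L M → ℝ) (t : Fin 3 → ℝ) :
    conj (∏ s : Λ L M, Complex.exp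
        (-((K : ℂ) * genF c (P (fun x i => (TorusChart.piProdZMod 2 L M).d₀ (fun y => φ (-y)) x i - t i) s))
          + (((K / 2 * Q (P (fun x i => (TorusChart.piProdZMod 2 L M).d₀ (fun y => φ (-y)) x i - t i) s)) : ℝ) : ℂ))) =
      ∏ s : Λ L M, Complex.exp
        (-((K : ℂ) * genF c (P (fun x i => (TorusChart.piProdZMod 2 L M).d₀ φ x i - -t i) s))
          + (((K / 2 * Q (P (fun x i => (TorusChart.piProdZMod 2 L M).d₀ φ x i - -t i) s)) : ℝ) : ℂ)) := by
  rw [map_prod]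
  obtain ⟨e, he⟩ := hsc_twc_transfer P hPdef
    (fun u => conj (Complex.exp (-((K : ℂ) * genF c u) + (((K / 2 * Q u) : ℝ) : ℂ))))
    (fun u => Complex.exp (-((K : ℂ) * genF c u) + (((K / 2 * Q u) : ℝ) : ℂ)))
    (fun u => by
      rw [hsc_twc_genF_RP c hR hP u, hsc_twc_Q_RP c hR hP Q hQ u, ← Complex.exp_conj]
      simp only [map_add, map_neg, map_mul, Complex.conj_ofReal, Complex.conj_conj])
    (fun u C => by
      rw [hsc_twc_genF_add_const c hU1 u C, hsc_twc_Q_add_const c hU1 Q hQ u C])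
    φ t
  exact Fintype.prod_equiv e _ _ he

end Twist

/-- **The bond weights are reflection invariant up to the sign of the twist.**  For an even single-bond weight `g`,
`Π_{x,i} g(d₀φ̃(x,i) − t i) = Π_{x,i} g(d₀φ(x,i) + t i)` for `φ̃ = φ ∘ neg`: `d₀φ̃(x,i) = −d₀φ(−x−e_i, i)` and `x ↦ −x − e_i`
is a bijection of the sites for each direction `i` (compare `bondWeight_comp_neg`). [folklore] -/
theorem hsc_twc_bond {β : Type*} [CommMonoid β] (L M : ℕ) [NeZero L] [NeZero M]
    (g : ℝ → β) (hg : ∀ s, g (-s) = g s) (φ : Λ L M → ℝ) (t : Fin 3 → ℝ) :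
    (∏ x : Λ L M, ∏ i : Fin 3, g ((TorusChart.piProdZMod 2 L M).d₀ (fun y => φ (-y)) x i - t i)) =
      ∏ x : Λ L M, ∏ i : Fin 3, g ((TorusChart.piProdZMod 2 L M).d₀ φ x i - -t i) := by
  rw [Finset.prod_comm]
  conv_rhs => rw [Finset.prod_comm]
  refine Finset.prod_congr rfl (fun i _ => ?_)
  symm
  refine Fintype.prod_equiv ((Equiv.neg (Λ L M)).trans
    (Equiv.subRight ((TorusChart.piProdZMod 2 L M).gen i))) _ _ (fun y => ?_)
  simp only [Equiv.trans_apply, Equiv.neg_apply, Equiv.subRight_apply, TorusChart.d₀_apply]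
  have e1 : -(-y - (TorusChart.piProdZMod 2 L M).gen i + (TorusChart.piProdZMod 2 L M).gen i) = y := by
    abel
  have e3 : -(-y - (TorusChart.piProdZMod 2 L M).gen i) = y + (TorusChart.piProdZMod 2 L M).gen i := by
    abel
  rw [e1, e3, ← hg]
  congr 1
  ring

/-! ## Measure: the site inversion of the punctured torus -/

/-- **The site inversion preserves the pinned integral.**  On the fields of the punctured torus the coordinate
permutation `ψ ↦ ψ ∘ neg` preserves Lebesgue measure (`volume_measurePreserving_piCongrLeft`) and
`extZero (ψ ∘ neg) = (extZero ψ) ∘ neg`, so `∫ H ((extZero ψ) ∘ neg) dψ = ∫ H (extZero ψ) dψ` for every `H`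
(`MeasurePreserving.integral_comp'`). [folklore] -/
theorem hsc_twc_integral_extZero_comp_neg (L M : ℕ) [NeZero L] [NeZero M] (H : (Λ L M → ℝ) → ℂ) :
    (∫ ψ : TorusChart.Punctured (Λ L M) → ℝ, H (fun y => TorusChart.extZero ψ (-y))) =
      ∫ ψ : TorusChart.Punctured (Λ L M) → ℝ, H (TorusChart.extZero ψ) := by
  set ν : TorusChart.Punctured (Λ L M) ≃ TorusChart.Punctured (Λ L M) :=
    (Equiv.neg (Λ L M)).subtypeEquiv (fun _ => neg_ne_zero.symm)
  set e : (TorusChart.Punctured (Λ L M) → ℝ) ≃ᵐ (TorusChart.Punctured (Λ L M) → ℝ) :=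
    (MeasurableEquiv.piCongrLeft (fun _ : TorusChart.Punctured (Λ L M) => ℝ) ν).symm
  have hmp : MeasurePreserving e volume volume :=
    (volume_measurePreserving_piCongrLeft (fun _ : TorusChart.Punctured (Λ L M) => ℝ) ν).symm _
  have happ : ∀ ψ : TorusChart.Punctured (Λ L M) → ℝ, (e ψ : TorusChart.Punctured (Λ L M) → ℝ) =
      fun x => ψ (ν x) := fun ψ => rfl
  have hext : ∀ ψ : TorusChart.Punctured (Λ L M) → ℝ,
      TorusChart.extZero (e ψ) = fun y => TorusChart.extZero ψ (-y) := by
    intro ψ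
    funext y
    by_cases hy : y = 0
    · rw [hy, neg_zero, TorusChart.extZero_zero, TorusChart.extZero_zero]
    · rw [happ, TorusChart.extZero_of_ne _ hy, TorusChart.extZero_of_ne _ (neg_ne_zero.mpr hy)]
      rfl
  have h := hmp.integral_comp' (fun ψ => H (TorusChart.extZero ψ))
  simpa only [hext] using h

/-- **Assembly.**  For a reflection-invariant real `A`, local factors with `conj (Φ₁ (φ ∘ neg)) = Φ₂ φ` and real bond
weights with `Π B₁ (φ ∘ neg) = Π B₂ φ`:
`conj ∫ e^{−A(ψ̂)} Φ₁(ψ̂) Π B₁(ψ̂) dψ = ∫ e^{−A(ψ̂)} Φ₂(ψ̂) Π B₂(ψ̂) dψ` (`integral_conj`, pointwise conjugation, and the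
substitution `ψ ↦ ψ ∘ neg` of `hsc_twc_integral_extZero_comp_neg`). [folklore] -/
theorem hsc_twc_assemble (L M : ℕ) [NeZero L] [NeZero M] (A : (Λ L M → ℝ) → ℝ)
    (Φ₁ Φ₂ : (Λ L M → ℝ) → ℂ) (B₁ B₂ : (Λ L M → ℝ) → Λ L M → Fin 3 → ℝ)
    (hA : ∀ φ : Λ L M → ℝ, A (fun y => φ (-y)) = A φ)
    (hΦ : ∀ φ : Λ L M → ℝ, conj (Φ₁ (fun y => φ (-y))) = Φ₂ φ)
    (hB : ∀ φ : Λ L M → ℝ, (∏ x : Λ L M, ∏ i : Fin 3, ((B₁ (fun y => φ (-y)) x i : ℝ) : ℂ)) =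
      ∏ x : Λ L M, ∏ i : Fin 3, ((B₂ φ x i : ℝ) : ℂ)) :
    conj (∫ ψ : TorusChart.Punctured (Λ L M) → ℝ,
        Complex.exp (-((A (TorusChart.extZero ψ) : ℝ) : ℂ)) *
          (Φ₁ (TorusChart.extZero ψ) *
            ∏ x : Λ L M, ∏ i : Fin 3, ((B₁ (TorusChart.extZero ψ) x i : ℝ) : ℂ))) =
      ∫ ψ : TorusChart.Punctured (Λ L M) → ℝ,
        Complex.exp (-((A (TorusChart.extZero ψ) : ℝ) : ℂ)) *
          (Φ₂ (TorusChart.extZero ψ) *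
            ∏ x : Λ L M, ∏ i : Fin 3, ((B₂ (TorusChart.extZero ψ) x i : ℝ) : ℂ)) := by
  have hpt : ∀ φ : Λ L M → ℝ,
      conj (Complex.exp (-((A φ : ℝ) : ℂ)) *
          (Φ₁ φ * ∏ x : Λ L M, ∏ i : Fin 3, ((B₁ φ x i : ℝ) : ℂ))) =
        Complex.exp (-((A (fun y => φ (-y)) : ℝ) : ℂ)) *
          (Φ₂ (fun y => φ (-y)) * ∏ x : Λ L M, ∏ i : Fin 3, ((B₂ (fun y => φ (-y)) x i : ℝ) : ℂ)) := by
    intro φ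
    have hφ : (fun y : Λ L M => φ (-(-y))) = φ := funext fun y => by rw [neg_neg]
    have hA' := hA (fun y => φ (-y))
    have hΦ' := hΦ (fun y => φ (-y))
    have hB' := hB (fun y => φ (-y))
    rw [hφ] at hA' hΦ' hB'
    rw [map_mul, map_mul, ← Complex.exp_conj, map_neg, Complex.conj_ofReal, hA', hΦ', ← hB']
    congr 2
    simp only [map_prod, Complex.conj_ofReal]
  rw [← integral_conj]
  refine (integral_congr_ae (ae_of_all _ fun ψ => hpt (TorusChart.extZero ψ))).trans ?_
  exact hsc_twc_integral_extZero_comp_neg L M (fun χ => Complex.exp (-((A χ : ℝ) : ℂ)) *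
    (Φ₂ χ * ∏ x : Λ L M, ∏ i : Fin 3, ((B₂ χ x i : ℝ) : ℂ)))

/-! ## The registered stub -/

/-- **Stub H5 `stub_twistIntegralConj` (registered signature, verbatim): conjugating the twisted vortex-free integrals
flips the twist.**  Under (U1), (R), (P): for every constant real twist `x i ↦ t i` the pinned R9-type integral
`I(t) = ∫ e^{−(K/2)Σ_s Q(P_s d₀ψ̂)} Π_s exp(−K genF c(P_s(d₀ψ̂ − t)) + (K/2)Q(P_s(d₀ψ̂ − t))) · Π_{x,i} W_v(d₀ψ̂(x,i) − t i) dψ`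
(`ψ̂ = extZero ψ`) satisfies `conj I(t) = I(−t)` (substitute `ψ ↦ ψ ∘ neg`, a volume-preserving coordinate permutation of
`Punctured Λ → ℝ`; `d₀(ψ̂∘neg)(x,i) = −d₀ψ̂(−x−e_i,i)`; window configurations go to `u ∘ RP −` const with
`genF c (u∘RP) = conj genF c u` ((R)∧(P)), `Q(u∘RP) = Q u`, and constant shifts invisible by (U1); the constant cochain
`t` goes to `−t` up to such a constant; the smoothed box is even, `smoothedBox_even`).  With E7/H1 this makes the
vortex-free series real term-by-term-pair `h ↔ −h`. [folklore] -/
theorem stub_twistIntegralConj :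
    ∀ (r : ℕ) (K : ℝ) (c : Table r), (∀ n ∈ c.support, ∑ w, n w = 0) →
      (∀ n : Freq r, c (fun w => n (w.1, w.2.1, Fin.rev w.2.2)) = (starRingEnd ℂ) (c (-n))) →
      (∀ n : Freq r, c (fun w => n (Fin.rev w.1, Fin.rev w.2.1, w.2.2)) = c n) →
      ∀ (L M : ℕ) [NeZero L] [NeZero M] (v : NNReal)
      (P : (Λ L M → Fin 3 → ℝ) → Λ L M → W r → ℝ),
      (∀ (ω : Λ L M → Fin 3 → ℝ) (s : Λ L M) (w : W r), P ω s w =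
        (TorusChart.piProdZMod 2 L M).lineSum ω 0 (w.1 : ℕ) s
          + (TorusChart.piProdZMod 2 L M).lineSum ω 1 (w.2.1 : ℕ) (s + (w.1 : ℕ) • (TorusChart.piProdZMod 2 L M).gen 0)
          + (TorusChart.piProdZMod 2 L M).lineSum ω 2 (w.2.2 : ℕ)
            (s + (w.1 : ℕ) • (TorusChart.piProdZMod 2 L M).gen 0 + (w.2.1 : ℕ) • (TorusChart.piProdZMod 2 L M).gen 1)) →
      ∀ (Q : (W r → ℝ) → ℝ),
      (∀ u : W r → ℝ, Q u = (-c.sum (fun n a => a * (((∑ w, (n w : ℝ) * u w) ^ 2 : ℝ) : ℂ))).re) →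
      ∀ (t : Fin 3 → ℝ),
        (starRingEnd ℂ) (∫ ψ : TorusChart.Punctured (Λ L M) → ℝ,
            Complex.exp (-(((K / 2 * ∑ s : Λ L M, Q (P ((TorusChart.piProdZMod 2 L M).d₀
              (TorusChart.extZero ψ)) s)) : ℝ) : ℂ)) *
            ((∏ s : Λ L M, Complex.exp
              (-((K : ℂ) * genF c (P (fun x i => (TorusChart.piProdZMod 2 L M).d₀
                  (TorusChart.extZero ψ) x i - t i) s))
                + (((K / 2 * Q (P (fun x i => (TorusChart.piProdZMod 2 L M).d₀
                  (TorusChart.extZero ψ) x i - t i) s)) : ℝ) : ℂ))) *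
            ∏ x : Λ L M, ∏ i : Fin 3, ((∫ τ in Set.Icc (-Real.pi) Real.pi, ProbabilityTheory.gaussianPDFReal 0 v
              ((TorusChart.piProdZMod 2 L M).d₀ (TorusChart.extZero ψ) x i - t i - τ) : ℝ) : ℂ))) =
        ∫ ψ : TorusChart.Punctured (Λ L M) → ℝ,
            Complex.exp (-(((K / 2 * ∑ s : Λ L M, Q (P ((TorusChart.piProdZMod 2 L M).d₀
              (TorusChart.extZero ψ)) s)) : ℝ) : ℂ)) *
            ((∏ s : Λ L M, Complex.exp
              (-((K : ℂ) * genF c (P (fun x i => (TorusChart.piProdZMod 2 L M).d₀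
                  (TorusChart.extZero ψ) x i - (-t i)) s))
                + (((K / 2 * Q (P (fun x i => (TorusChart.piProdZMod 2 L M).d₀
                  (TorusChart.extZero ψ) x i - (-t i)) s)) : ℝ) : ℂ))) *
            ∏ x : Λ L M, ∏ i : Fin 3, ((∫ τ in Set.Icc (-Real.pi) Real.pi, ProbabilityTheory.gaussianPDFReal 0 v
              ((TorusChart.piProdZMod 2 L M).d₀ (TorusChart.extZero ψ) x i - (-t i) - τ) : ℝ) : ℂ)) := by
  intro r K c hU1 hR hP L M _ _ v P hPdef Q hQ t
  exact hsc_twc_assemble L M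
    (fun φ => K / 2 * ∑ s : Λ L M, Q (P ((TorusChart.piProdZMod 2 L M).d₀ φ) s))
    (fun φ => ∏ s : Λ L M, Complex.exp
      (-((K : ℂ) * genF c (P (fun x i => (TorusChart.piProdZMod 2 L M).d₀ φ x i - t i) s))
        + (((K / 2 * Q (P (fun x i => (TorusChart.piProdZMod 2 L M).d₀ φ x i - t i) s)) : ℝ) : ℂ)))
    (fun φ => ∏ s : Λ L M, Complex.exp
      (-((K : ℂ) * genF c (P (fun x i => (TorusChart.piProdZMod 2 L M).d₀ φ x i - (-t i)) s))
        + (((K / 2 * Q (P (fun x i => (TorusChart.piProdZMod 2 L M).d₀ φ x i - (-t i)) s)) : ℝ) : ℂ)))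
    (fun φ x i => ∫ τ in Set.Icc (-Real.pi) Real.pi, ProbabilityTheory.gaussianPDFReal 0 v
      ((TorusChart.piProdZMod 2 L M).d₀ φ x i - t i - τ))
    (fun φ x i => ∫ τ in Set.Icc (-Real.pi) Real.pi, ProbabilityTheory.gaussianPDFReal 0 v
      ((TorusChart.piProdZMod 2 L M).d₀ φ x i - (-t i) - τ))
    (fun φ => by rw [hsc_twc_thin P hPdef c hU1 hR hP Q hQ φ])
    (fun φ => hsc_twc_local P hPdef c hU1 hR hP Q hQ K φ t)
    (fun φ => hsc_twc_bond L M
      (fun s => ((∫ τ in Set.Icc (-Real.pi) Real.pi, ProbabilityTheory.gaussianPDFReal 0 v (s - τ) : ℝ) : ℂ))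
      (fun s => by rw [smoothedBox_even]) φ t)

end Summit.HubbardSuperconductivity.HubbardSuperconductivity.Theorems.FSUnfolding

end
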